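import Mathlib
import HarnessLib
import Summits.Ventures.LatticeQCDFlow.Scoring.IndependentSumLimit
import Summits.Ventures.LatticeQCDFlow.Scoring.CramerWoldDevice

/-!
# JOINT convergence in distribution of INDEPENDENT components, and Cramér–Wold uniqueness:
# `Xₙ ⇒ Z₁`, `Yₙ ⇒ Z₂`, `Xₙ ⟂ Yₙ`, `Z₁ ⟂ Z₂` ⇒ `(Xₙ, Yₙ) ⇒ (Z₁, Z₂)` in `ℝ × ℝ`

HONEST FRAMING: exact (Metropolis-corrected) sampling algorithms for lattice gauge theory;
figures of merit are autocorrelation/cost numbers at stated couplings and volumes; no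
continuum-physics claim.

Venture `LatticeQCDFlow` (cell pub-lqcd), topic `Scoring`; FANOUT row 4 (`s0-u1-b`, rung S0-B:
two independent codes compared).  `Scoring/IndependentSumLimit` gave the limit of the SUM (or
difference) of two independent statistics; a general comparison of two codes — a ratio of
acceptances, a speed-up factor, any continuous `g(θ̂^A, θ̂^B)` — needs the JOINT limit of the
pair, after which Mathlib's continuous mapping theorem and the delta method
(`Scoring/MultivariateDeltaMethod`) apply.  This file proves it:
**`tendstoInDistribution_prodMk_of_indepFun`**.  Proof: read the pair in the inner product space
`WithLp 2 (ℝ × ℝ)`, where the Cramér–Wold device (`Scoring/CramerWoldDevice`) reduces joint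
convergence to that of `t₁Xₙ + t₂Yₙ`, an independent sum handled by
`tendstoInDistribution_add_of_indepFun`; return to `ℝ × ℝ` by the continuous `WithLp.ofLp`.  Also
the uniqueness half of Cramér–Wold: a finite measure on a finite-dimensional inner product space
is determined by its one-dimensional projections (**`measure_eq_of_forall_map_inner_eq`**,
from Mathlib's `Measure.ext_of_charFun`).  NEW WORK of the cell (classical; not in Mathlib);
no definition; nothing cited as a fact.

## Content

* **`measure_eq_of_forall_map_inner_eq`** — Cramér–Wold uniqueness;
* `inner_toLp_prod` — `⟪t, (x, y)⟫ = t₁x + t₂y` in `WithLp 2 (ℝ × ℝ)`;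
* **`tendstoInDistribution_prodMk_of_indepFun`** — joint limit of independent components;
* `tendstoInDistribution_prodMk_twoCodes` — the same for two codes read on `P_A ⊗ P_B`.

NOT CLAIMED: more than two components (iterate, or use `EuclideanSpace`); dependent
components (that is Slutsky / genuinely joint CLTs, `Scoring/MultivariateCLT`).
-/

noncomputable section

namespace Summit.Ventures.LatticeQCDFlow.Scoring.CardConsistency

open MeasureTheory ProbabilityTheory Filter WithLp
open scoped Topology RealInnerProductSpace

/-! ## §1 Cramér–Wold uniqueness -/

section Uniqueness

variable {E : Type*} [NormedAddCommGroup E] [InnerProductSpace ℝ E] [CompleteSpace E]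
  [SecondCountableTopology E] [MeasurableSpace E] [BorelSpace E]

/-- **CRAMÉR–WOLD UNIQUENESS**: two finite measures on an inner product space whose images under
every projection `x ↦ ⟪t, x⟫` agree are equal. [ours] (characteristic functions:
`φ_μ(t) = φ_{⟪t,·⟫∗μ}(1)`, and Mathlib's `Measure.ext_of_charFun`) -/
theorem measure_eq_of_forall_map_inner_eq (μ ν : Measure E) [IsFiniteMeasure μ]
    [IsFiniteMeasure ν] (h : ∀ t : E, μ.map (fun x => ⟪t, x⟫) = ν.map (fun x => ⟪t, x⟫)) :
    μ = ν := by
  apply Measure.ext_of_charFun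
  funext t
  rw [charFun_eq_charFun_map_inner μ t, charFun_eq_charFun_map_inner ν t, h t]

end Uniqueness

/-! ## §2 Joint convergence of independent components -/

section Joint

variable {Ω : Type*} [MeasurableSpace Ω] {P : Measure Ω} [IsProbabilityMeasure P]
variable {Ω' : Type*} [MeasurableSpace Ω'] {P' : Measure Ω'} [IsProbabilityMeasure P']

/-- In `WithLp 2 (ℝ × ℝ)`: `⟪t, (x, y)⟫ = t₁·x + t₂·y`. [folklore] -/
theorem inner_toLp_prod (t : WithLp 2 (ℝ × ℝ)) (x y : ℝ) :
    ⟪t, toLp 2 (x, y)⟫ = (ofLp t).1 * x + (ofLp t).2 * y := by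
  rw [prod_inner_apply]
  simp [mul_comm]

/-- **INDEPENDENT COMPONENTS CONVERGE JOINTLY.**  Real statistics `Xₙ ⇒ Z₁`, `Yₙ ⇒ Z₂` with
`Xₙ ⟂ Yₙ` for every `n` and `Z₁ ⟂ Z₂` ⇒ `(Xₙ, Yₙ) ⇒ (Z₁, Z₂)` in `ℝ × ℝ`. [ours] (Cramér–Wold
in `WithLp 2 (ℝ × ℝ)`: `t₁Xₙ + t₂Yₙ ⇒ t₁Z₁ + t₂Z₂` by `tendstoInDistribution_add_of_indepFun`) -/
theorem tendstoInDistribution_prodMk_of_indepFun {X Y : ℕ → Ω → ℝ} {Z₁ Z₂ : Ω' → ℝ}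
    (hX : TendstoInDistribution X atTop Z₁ (fun _ => P) P')
    (hY : TendstoInDistribution Y atTop Z₂ (fun _ => P) P')
    (hXY : ∀ n, IndepFun (X n) (Y n) P) (hZ : IndepFun Z₁ Z₂ P') :
    TendstoInDistribution (fun n ω => (X n ω, Y n ω)) atTop (fun ω' => (Z₁ ω', Z₂ ω'))
      (fun _ => P) P' := by
  -- the pair, read in the inner product space `WithLp 2 (ℝ × ℝ)`
  have hVm : ∀ n, AEMeasurable (fun ω => toLp 2 (X n ω, Y n ω)) P := fun n =>
    (measurable_toLp 2 (ℝ × ℝ)).comp_aemeasurable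
      ((hX.forall_aemeasurable n).prodMk (hY.forall_aemeasurable n))
  have hVZ : AEMeasurable (fun ω' => toLp 2 (Z₁ ω', Z₂ ω')) P' :=
    (measurable_toLp 2 (ℝ × ℝ)).comp_aemeasurable
      (hX.aemeasurable_limit.prodMk hY.aemeasurable_limit)
  have hV : TendstoInDistribution (fun n ω => toLp 2 (X n ω, Y n ω)) atTop
      (fun ω' => toLp 2 (Z₁ ω', Z₂ ω')) (fun _ => P) P' := by
    refine tendstoInDistribution_of_forall_inner (P := fun _ => P) hVm hVZ fun t => ?_
    have h1 : TendstoInDistribution (fun n ω => (ofLp t).1 * X n ω) atTop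
        (fun ω' => (ofLp t).1 * Z₁ ω') (fun _ => P) P' :=
      hX.continuous_comp (continuous_const.mul continuous_id)
    have h2 : TendstoInDistribution (fun n ω => (ofLp t).2 * Y n ω) atTop
        (fun ω' => (ofLp t).2 * Z₂ ω') (fun _ => P) P' :=
      hY.continuous_comp (continuous_const.mul continuous_id)
    have hsum := tendstoInDistribution_add_of_indepFun h1 h2
      (fun n => (hXY n).comp (measurable_const_mul _) (measurable_const_mul _))
      (hZ.comp (measurable_const_mul _) (measurable_const_mul _))
    refine hsum.congr (fun n => Eventually.of_forall fun ω => ?_)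
      (Eventually.of_forall fun ω' => ?_)
    · exact (inner_toLp_prod t _ _).symm
    · exact (inner_toLp_prod t _ _).symm
  -- back to `ℝ × ℝ`
  exact hV.continuous_comp (prod_continuous_ofLp 2 ℝ ℝ)

end Joint

/-! ## §3 Two codes on the product space -/

section TwoCodes

variable {ΩA : Type*} [MeasurableSpace ΩA] {PA : Measure ΩA} [IsProbabilityMeasure PA]
variable {ΩB : Type*} [MeasurableSpace ΩB] {PB : Measure ΩB} [IsProbabilityMeasure PB]
variable {Ω' : Type*} [MeasurableSpace Ω'] {P' : Measure Ω'} [IsProbabilityMeasure P']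

/-- **TWO INDEPENDENT CODES CONVERGE JOINTLY**: `Xₙ ⇒ Z₁` under `P_A`, `Yₙ ⇒ Z₂` under `P_B`,
`Z₁ ⟂ Z₂` ⇒ `(ω_A, ω_B) ↦ (Xₙ(ω_A), Yₙ(ω_B))` converges in distribution to `(Z₁, Z₂)` under
`P_A ⊗ P_B`. [ours] -/
theorem tendstoInDistribution_prodMk_twoCodes {X : ℕ → ΩA → ℝ} {Y : ℕ → ΩB → ℝ}
    {Z₁ Z₂ : Ω' → ℝ} (hX : TendstoInDistribution X atTop Z₁ (fun _ => PA) P')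
    (hY : TendstoInDistribution Y atTop Z₂ (fun _ => PB) P') (hZ : IndepFun Z₁ Z₂ P') :
    TendstoInDistribution (fun n (ω : ΩA × ΩB) => (X n ω.1, Y n ω.2)) atTop
      (fun ω' => (Z₁ ω', Z₂ ω')) (fun _ => PA.prod PB) P' :=
  tendstoInDistribution_prodMk_of_indepFun (tendstoInDistribution_comp_fst hX)
    (tendstoInDistribution_comp_snd hY)
    (fun n => indepFun_prod₀ (hX.forall_aemeasurable n) (hY.forall_aemeasurable n)) hZ

end TwoCodes

end Summit.Ventures.LatticeQCDFlow.Scoring.CardConsistency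

end
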